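import Mathlib
import Summits.NavierStokesRegularity.NavierStokesRegularity.Theorems.TypeIQuarterGateScarEnvelopeTypeISatelliteTowerGalleryTransitive
import Summits.NavierStokesRegularity.NavierStokesRegularity.Theorems.TypeIQuarterGateScarEnvelopeTypeISatelliteTowerGallerySeqCompact
import Summits.NavierStokesRegularity.NavierStokesRegularity.Theorems.TypeIQuarterGateScarEnvelopeTypeISatelliteTowerRateLadder

/-!
# The gallery-wise minimal singular rate is ATTAINED

For an A–B object `(U, P, H)` of rate `M` whose gallery contains a scar (an A–B gallery limit
singular at some final-time point — e.g. `U` itself rooted), there is an A–B gallery limit `W` of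
`U`, with `𝐈(W) ≤ 4·𝐈(U)`, singular at the ROOT, whose tight rate at the root is MINIMAL among the
tight rates of all scars of all A–B gallery limits of `U`, and this minimal rate `m_*` is realised as
an honest rate on the unit cylinder: `√(−s)‖W(s,z)‖ ≤ m_*` on `(−1,0) × B(0,1)` (so even the
infimum defining `tightRate W 0` is attained).

This is rung (L9) `GalleryMinRateAttained` of the crux idea `Cruxes/ScarEnvelopeTypeI/Ideas/
zoom-recurrence.md` (ns-idea-17 g0) — the instrument row R38-α «compact rate window» / the OPEN
hypothesis shape (S∞) `MinSingRateAttained` of nsreg-p3 ROUND-34/37 with «class `M`» replaced by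
«the gallery of ONE object», where the obstacle (M𝐈₁) (no uniform `𝐈` across the class) is absent:
inside one gallery `𝐈 ≤ 4·𝐈(U)` uniformly (`abTower_of_isGalleryLimit`), so a minimising sequence of
gallery scars — recentred and zoomed so that the near-minimal rate holds on the unit cylinder
(`IsGalleryLimit.galleryMap`) — is sequentially compact (`abTower_seqCompact`), its scars persist
(A–B Prop. 2.3), the rate passes to the limit a.e. and then everywhere (continuity of A–B objects,
`rate_everywhere_of_ae`), and the limit is again a gallery limit of `U` (the gallery is closed in
`L³_loc`, `IsGalleryLimit.of_tendsto`) with an A–B representative of budget `≤ 4·𝐈(U)`.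

HONEST FRAMING: a compactness / normal-form theorem about hypothetical Type-I ancient objects for
the crux `TypeIQuarterGate.ScarEnvelopeTypeI` (item 23843).  It does NOT touch the class-wide
(S∞) / `MinSingRateAttained M` (no uniform `𝐈` across `ABTower M`), and nothing open is proved —
23843, `∀ M, ¬ OneScarLeaf M`, `∀ M, ¬ InfiniteDescent M`, the route and Navier–Stokes regularity are
OPEN.  LEAD-lineage prover ns-sz-p1 g6; `--supports stmt-NavierStokesRegularity-23843 --as helper`.
-/

noncomputable section

-- the summit-side namespace repeats a component by design (single-conjunct summit, D-0017)
set_option linter.dupNamespace false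

open MeasureTheory Set Metric Filter Topology
open scoped ENNReal

namespace Summit.NavierStokesRegularity.NavierStokesRegularity.Cruxes.ScarEnvelopeTypeI.ZoomDictionary

section GalleryMinRate

open Literature.Analysis.FluidPDE
variable {U V V' W : ℝ → (EuclideanSpace ℝ (Fin 3)) → (EuclideanSpace ℝ (Fin 3))}
  {P : ℝ → (EuclideanSpace ℝ (Fin 3)) → ℝ}

/-! ### Small tools -/

/-- A–B objects lie in `L³` of every backward cylinder `Q_R(0)` (the scaled cube `C(R)` is bounded
by `𝐈 < ∞`). -/
theorem ABTower.l3loc {M : ℝ}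
    {H : ℝ → (EuclideanSpace ℝ (Fin 3)) → (EuclideanSpace ℝ (Fin 3)) →L[ℝ] (EuclideanSpace ℝ (Fin 3))}
    (h : ABTower M U P H) : L3loc U := by
  intro R hR
  refine ⟨h.aestronglyMeasurable_uncurry hR, ?_⟩
  refine lt_of_le_of_lt (LocalTypeIBlowup.eLpNorm_velocity_ball_le hR
    (parabolicCylinder_origin_subset_slab R) P H) ?_
  exact ENNReal.rpow_lt_top_of_nonneg (by norm_num)
    (ENNReal.mul_ne_top (ENNReal.pow_ne_top ENNReal.ofReal_ne_top) h.2.2.2.ne)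

/-- A ROOTED A–B object is a scar-carrying gallery limit of itself. -/
theorem ABTower.isGalleryLimit_refl {M : ℝ}
    {H : ℝ → (EuclideanSpace ℝ (Fin 3)) → (EuclideanSpace ℝ (Fin 3)) →L[ℝ] (EuclideanSpace ℝ (Fin 3))}
    (h : ABTower M U P H) : IsGalleryLimit U U :=
  isGalleryLimit_self h.l3loc

/-- Gallery limits are insensitive to a.e. modification of the limit on the backward cylinders. -/
theorem IsGalleryLimit.congr_ae (h : IsGalleryLimit U V)
    (hae : ∀ R : ℝ, 0 < R → ∀ᵐ z ∂(volume.restrict (parabolicCylinder R (0 : ℝ × (EuclideanSpace ℝ (Fin 3))))),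
      V z.1 z.2 = V' z.1 z.2) : IsGalleryLimit U V' := by
  obtain ⟨hV3, x, l, hl, hconv⟩ := h
  have hae' : ∀ R : ℝ, 0 < R →
      Function.uncurry V =ᵐ[volume.restrict (parabolicCylinder R (0 : ℝ × (EuclideanSpace ℝ (Fin 3))))]
        Function.uncurry V' := fun R hR => (hae R hR).mono fun z hz => hz
  refine ⟨fun R hR => (hV3 R hR).ae_eq (hae' R hR), x, l, hl, fun R hR => ?_⟩
  refine (hconv R hR).congr fun j => eLpNorm_congr_ae ?_
  exact (hae' R hR).mono fun z hz => by simp only [Pi.sub_apply, hz]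

/-- Regularity at the root is insensitive to a.e. modification on the backward cylinders `Q_R(0)`. -/
theorem regPt_zero_of_ae_eq (h : RegPt V 0)
    (hae : ∀ R : ℝ, 0 < R → ∀ᵐ z ∂(volume.restrict (parabolicCylinder R (0 : ℝ × (EuclideanSpace ℝ (Fin 3))))),
      V z.1 z.2 = V' z.1 z.2) : RegPt V' 0 := by
  obtain ⟨r, hr, M', hM'⟩ := h
  refine ⟨r, hr, M', ?_⟩
  have e : (((0 : ℝ), (0 : (EuclideanSpace ℝ (Fin 3)))) : ℝ × (EuclideanSpace ℝ (Fin 3))) =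
      (0 : ℝ × (EuclideanSpace ℝ (Fin 3))) := rfl
  rw [e] at hM' ⊢
  filter_upwards [hM', hae r hr] with z hz hzz
  rw [← hzz]
  exact hz

/-- **The gallery is closed in `L³_loc`**: an `L³_loc` limit (on every `Q_R(0)`) of gallery limits of
`U` is a gallery limit of `U` (diagonal extraction, as for transitivity). -/
theorem IsGalleryLimit.of_tendsto
    (hU : ∀ R : ℝ, 0 < R → AEStronglyMeasurable (Function.uncurry U)
      (volume.restrict (parabolicCylinder R (0 : ℝ × (EuclideanSpace ℝ (Fin 3))))))
    {Vs : ℕ → ℝ → (EuclideanSpace ℝ (Fin 3)) → (EuclideanSpace ℝ (Fin 3))}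
    (hV : ∀ n, IsGalleryLimit U (Vs n)) (hW : L3loc W)
    (hconv : ∀ R : ℝ, 0 < R → Tendsto (fun n => eLpNorm
      (Function.uncurry (Vs n) - Function.uncurry W) 3
      (volume.restrict (parabolicCylinder R (0 : ℝ × (EuclideanSpace ℝ (Fin 3)))))) atTop (𝓝 0)) :
    IsGalleryLimit U W := by
  refine ⟨hW, ?_⟩
  set Q : ℕ → Set (ℝ × (EuclideanSpace ℝ (Fin 3))) :=
    fun n => parabolicCylinder ((n : ℝ) + 1) (0 : ℝ × (EuclideanSpace ℝ (Fin 3))) with hQ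
  have hnpos : ∀ n : ℕ, (0 : ℝ) < (n : ℝ) + 1 := fun n => by positivity
  have hθ : ∀ n : ℕ, (0 : ℝ≥0∞) < ((n : ℝ≥0∞) + 1)⁻¹ := fun n =>
    ENNReal.inv_pos.2 (by simp)
  -- first choice: `i n` with `‖Vs (i n) − W‖_{L³(Q_{n+1})} ≤ (n+1)⁻¹`
  have hex1 : ∀ n : ℕ, ∃ i : ℕ, eLpNorm (Function.uncurry (Vs i) - Function.uncurry W) 3
      (volume.restrict (Q n)) ≤ ((n : ℝ≥0∞) + 1)⁻¹ := fun n =>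
    ((ENNReal.tendsto_nhds_zero.1 (hconv _ (hnpos n))) _ (hθ n)).exists
  choose i hi using hex1
  -- the data of the gallery limits `Vs (i n)`
  have hdata : ∀ n : ℕ, ∃ (x : ℕ → (EuclideanSpace ℝ (Fin 3))) (l : ℕ → ℝ), (∀ j, 0 < l j) ∧
      ZoomsTendsto U x l (Vs (i n)) := fun n => (hV (i n)).2
  choose x l hl hxl using hdata
  -- second choice: `j n` with `‖zoom U (x n (j n)) (l n (j n)) − Vs (i n)‖_{L³(Q_{n+1})} ≤ (n+1)⁻¹`
  have hex2 : ∀ n : ℕ, ∃ j : ℕ, eLpNorm (Function.uncurry (zoom U (x n j) 0 (l n j)) -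
      Function.uncurry (Vs (i n))) 3 (volume.restrict (Q n)) ≤ ((n : ℝ≥0∞) + 1)⁻¹ := fun n =>
    ((ENNReal.tendsto_nhds_zero.1 ((hxl n) _ (hnpos n))) _ (hθ n)).exists
  choose j hj using hex2
  refine ⟨fun n => x n (j n), fun n => l n (j n), fun n => hl n (j n), fun R hR => ?_⟩
  have hbound : ∀ n : ℕ, R ≤ (n : ℝ) + 1 →
      eLpNorm (Function.uncurry (zoom U (x n (j n)) 0 (l n (j n))) - Function.uncurry W) 3
          (volume.restrict (parabolicCylinder R (0 : ℝ × (EuclideanSpace ℝ (Fin 3))))) ≤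
        ((n : ℝ≥0∞) + 1)⁻¹ + ((n : ℝ≥0∞) + 1)⁻¹ := by
    intro n hn
    have hsub : parabolicCylinder R (0 : ℝ × (EuclideanSpace ℝ (Fin 3))) ⊆ Q n :=
      parabolicCylinder_mono hR.le hn _
    refine le_trans (eLpNorm_mono_measure _ (Measure.restrict_mono hsub le_rfl)) ?_
    have hA : AEStronglyMeasurable (Function.uncurry (zoom U (x n (j n)) 0 (l n (j n))))
        (volume.restrict (Q n)) :=
      aestronglyMeasurable_uncurry_zoom hU _ (hl n (j n)) (hnpos n)
    have hB : AEStronglyMeasurable (Function.uncurry (Vs (i n))) (volume.restrict (Q n)) :=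
      ((hV (i n)).1 _ (hnpos n)).1
    have hC : AEStronglyMeasurable (Function.uncurry W) (volume.restrict (Q n)) := (hW _ (hnpos n)).1
    have e : Function.uncurry (zoom U (x n (j n)) 0 (l n (j n))) - Function.uncurry W =
        (Function.uncurry (zoom U (x n (j n)) 0 (l n (j n))) - Function.uncurry (Vs (i n))) +
        (Function.uncurry (Vs (i n)) - Function.uncurry W) := by abel
    rw [e]
    exact (eLpNorm_add_le (hA.sub hB) (hB.sub hC) (by norm_num)).trans (add_le_add (hj n) (hi n))
  have hθ0 : Tendsto (fun n : ℕ => ((n : ℝ≥0∞) + 1)⁻¹ + ((n : ℝ≥0∞) + 1)⁻¹) atTop (𝓝 0) := by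
    have h1 : Tendsto (fun n : ℕ => ((n : ℝ≥0∞) + 1)⁻¹) atTop (𝓝 0) := by
      have h := ENNReal.tendsto_inv_nat_nhds_zero.comp (tendsto_add_atTop_nat 1)
      refine h.congr fun n => ?_
      simp only [Function.comp_apply, Nat.cast_add, Nat.cast_one]
    simpa using h1.add h1
  refine ENNReal.tendsto_nhds_zero.2 fun ε hε => ?_
  obtain ⟨N, hN⟩ := exists_nat_ge R
  filter_upwards [(ENNReal.tendsto_nhds_zero.1 hθ0) ε hε, eventually_ge_atTop N] with n hn hnN
  refine (hbound n ?_).trans hn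
  calc R ≤ (N : ℝ) := hN
    _ ≤ (n : ℝ) := by exact_mod_cast hnN
    _ ≤ (n : ℝ) + 1 := by linarith

/-- **Recentring a local rate onto the unit cylinder**: a rate `m` of `W` on
`(−δ², 0) × B(y, δ)` is a rate `m` of the zoom `zoom W y 0 δ` on `(−1, 0) × B(0, 1)`. -/
theorem rate_unit_of_rate {y : (EuclideanSpace ℝ (Fin 3))} {m δ : ℝ} (hδ : 0 < δ)
    (hr : ∀ t ∈ Ioo (-(δ ^ 2)) 0, ∀ x ∈ ball y δ, Real.sqrt (-t) * ‖W t x‖ ≤ m) :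
    ∀ s ∈ Ioo (-((1 : ℝ) ^ 2)) 0, ∀ z ∈ ball (0 : (EuclideanSpace ℝ (Fin 3))) 1,
      Real.sqrt (-s) * ‖zoom W y 0 δ s z‖ ≤ m := by
  intro s hs z hz
  rw [one_pow] at hs
  have hδ2 : 0 < δ ^ 2 := pow_pos hδ 2
  have ht : 0 + δ ^ 2 * s ∈ Ioo (-(δ ^ 2)) 0 := by
    rw [zero_add]
    constructor <;> nlinarith [hs.1, hs.2]
  have hx : y + δ • z ∈ ball y δ := by
    rw [mem_ball, dist_eq_norm, add_sub_cancel_left, norm_smul, Real.norm_of_nonneg hδ.le]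
    have hz' : ‖z‖ < 1 := by rwa [mem_ball_zero_iff] at hz
    nlinarith
  have h := hr _ ht _ hx
  have hsq : Real.sqrt (-(0 + δ ^ 2 * s)) = δ * Real.sqrt (-s) := by
    rw [zero_add, show -(δ ^ 2 * s) = δ ^ 2 * (-s) by ring, Real.sqrt_mul (sq_nonneg _),
      Real.sqrt_sq hδ.le]
  rw [hsq] at h
  simp only [zoom, norm_smul, Real.norm_of_nonneg hδ.le]
  calc Real.sqrt (-s) * (δ * ‖W (0 + δ ^ 2 * s) (y + δ • z)‖)
      = δ * Real.sqrt (-s) * ‖W (0 + δ ^ 2 * s) (y + δ • z)‖ := by ring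
    _ ≤ m := h

/-- From a rate EVERYWHERE on `(−1,0) × B(0,1)` to the rate a.e. on `Q_1(0)`. -/
theorem rate_ae_unit_of_everywhere {m : ℝ}
    (h : ∀ s ∈ Ioo (-((1 : ℝ) ^ 2)) 0, ∀ z ∈ ball (0 : (EuclideanSpace ℝ (Fin 3))) 1,
      Real.sqrt (-s) * ‖W s z‖ ≤ m) :
    ∀ᵐ z ∂(volume.restrict (parabolicCylinder 1 (0 : ℝ × (EuclideanSpace ℝ (Fin 3))))),
      Real.sqrt (-z.1) * ‖W z.1 z.2‖ ≤ m := by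
  filter_upwards [ae_restrict_mem (isOpen_parabolicCylinder 1
    (0 : ℝ × (EuclideanSpace ℝ (Fin 3)))).measurableSet] with z hz
  rw [mem_parabolicCylinder] at hz
  obtain ⟨⟨h1, h2⟩, h3⟩ := hz
  simp only [Prod.fst_zero, Prod.snd_zero, zero_sub] at h1 h2 h3
  exact h z.1 ⟨h1, h2⟩ z.2 h3

/-! ### The attained minimum -/

/-- **THE GALLERY-WISE MINIMAL SINGULAR RATE IS ATTAINED** (rung (L9) of ns-idea-17's
`zoom-recurrence`; nsreg-p3's (S∞) with «class» ↦ «gallery»).  Let `(U, P, H)` be an A–B object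
of rate `M` whose gallery carries a scar: some A–B gallery limit `W₀` of `U` is singular at some
final-time point `y₀`.  Then there is an A–B gallery limit `W` of `U` with `𝐈(W) ≤ 4·𝐈(U)`,
SINGULAR AT THE ROOT, whose root tight rate is realised on the unit cylinder
(`√(−s)‖W(s,z)‖ ≤ tightRate W 0` on `(−1,0) × B(0,1)`) and is MINIMAL among the tight rates of
all scars of all A–B gallery limits of `U`. -/
theorem ABTower.exists_galleryMinimiser {M : ℝ}
    {H : ℝ → (EuclideanSpace ℝ (Fin 3)) → (EuclideanSpace ℝ (Fin 3)) →L[ℝ] (EuclideanSpace ℝ (Fin 3))}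
    (h : ABTower M U P H)
    {W₀ : ℝ → (EuclideanSpace ℝ (Fin 3)) → (EuclideanSpace ℝ (Fin 3))} {P₀ : ℝ → (EuclideanSpace ℝ (Fin 3)) → ℝ}
    {H₀ : ℝ → (EuclideanSpace ℝ (Fin 3)) → (EuclideanSpace ℝ (Fin 3)) →L[ℝ] (EuclideanSpace ℝ (Fin 3))}
    {y₀ : (EuclideanSpace ℝ (Fin 3))}
    (h₀ : ABTower M W₀ P₀ H₀) (hg₀ : IsGalleryLimit U W₀) (hy₀ : ¬ RegPt W₀ y₀) :
    ∃ (W : ℝ → (EuclideanSpace ℝ (Fin 3)) → (EuclideanSpace ℝ (Fin 3))) (P' : ℝ → (EuclideanSpace ℝ (Fin 3)) → ℝ)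
      (H' : ℝ → (EuclideanSpace ℝ (Fin 3)) → (EuclideanSpace ℝ (Fin 3)) →L[ℝ] (EuclideanSpace ℝ (Fin 3))),
      ABTower M W P' H' ∧ IsGalleryLimit U W ∧
      typeIBound (Iio (0 : ℝ) ×ˢ univ) W P' H' ≤ 4 * typeIBound (Iio (0 : ℝ) ×ˢ univ) U P H ∧
      ¬ RegPt W 0 ∧
      (∀ s ∈ Ioo (-((1 : ℝ) ^ 2)) 0, ∀ z ∈ ball (0 : (EuclideanSpace ℝ (Fin 3))) 1,
        Real.sqrt (-s) * ‖W s z‖ ≤ tightRate W 0) ∧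
      ∀ (W₂ : ℝ → (EuclideanSpace ℝ (Fin 3)) → (EuclideanSpace ℝ (Fin 3))) (P₂ : ℝ → (EuclideanSpace ℝ (Fin 3)) → ℝ)
        (H₂ : ℝ → (EuclideanSpace ℝ (Fin 3)) → (EuclideanSpace ℝ (Fin 3)) →L[ℝ] (EuclideanSpace ℝ (Fin 3)))
        (y₂ : (EuclideanSpace ℝ (Fin 3))),
        ABTower M W₂ P₂ H₂ → IsGalleryLimit U W₂ → ¬ RegPt W₂ y₂ → tightRate W 0 ≤ tightRate W₂ y₂ := by
  -- ## the gallery-wise singular rates and their infimum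
  set S : Set ℝ := {r | ∃ (W₂ : ℝ → (EuclideanSpace ℝ (Fin 3)) → (EuclideanSpace ℝ (Fin 3)))
      (P₂ : ℝ → (EuclideanSpace ℝ (Fin 3)) → ℝ)
      (H₂ : ℝ → (EuclideanSpace ℝ (Fin 3)) → (EuclideanSpace ℝ (Fin 3)) →L[ℝ] (EuclideanSpace ℝ (Fin 3)))
      (y₂ : (EuclideanSpace ℝ (Fin 3))),
      ABTower M W₂ P₂ H₂ ∧ IsGalleryLimit U W₂ ∧ ¬ RegPt W₂ y₂ ∧ r = tightRate W₂ y₂} with hSdef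
  have hSbdd : BddBelow S := by
    refine ⟨0, ?_⟩
    rintro r ⟨W₂, P₂, H₂, y₂, hW₂, -, -, rfl⟩
    exact tightRate_nonneg (towerObj_of_abTower hW₂) y₂
  have hSne : S.Nonempty := ⟨_, W₀, P₀, H₀, y₀, h₀, hg₀, hy₀, rfl⟩
  set mstar : ℝ := sInf S with hmstar
  have hmstar_le : ∀ {W₂ : ℝ → (EuclideanSpace ℝ (Fin 3)) → (EuclideanSpace ℝ (Fin 3))}
      {P₂ : ℝ → (EuclideanSpace ℝ (Fin 3)) → ℝ}
      {H₂ : ℝ → (EuclideanSpace ℝ (Fin 3)) → (EuclideanSpace ℝ (Fin 3)) →L[ℝ] (EuclideanSpace ℝ (Fin 3))}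
      {y₂ : (EuclideanSpace ℝ (Fin 3))},
      ABTower M W₂ P₂ H₂ → IsGalleryLimit U W₂ → ¬ RegPt W₂ y₂ → mstar ≤ tightRate W₂ y₂ :=
    fun hW₂ hg₂ hy₂ => csInf_le hSbdd ⟨_, _, _, _, hW₂, hg₂, hy₂, rfl⟩
  -- ## a minimising sequence of gallery scars, recentred onto the unit cylinder
  have hθpos : ∀ n : ℕ, (0 : ℝ) < 1 / ((n : ℝ) + 1) := fun n => by positivity
  have hmin : ∀ n : ℕ, ∃ (Wn : ℝ → (EuclideanSpace ℝ (Fin 3)) → (EuclideanSpace ℝ (Fin 3)))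
      (Pn : ℝ → (EuclideanSpace ℝ (Fin 3)) → ℝ)
      (Hn : ℝ → (EuclideanSpace ℝ (Fin 3)) → (EuclideanSpace ℝ (Fin 3)) →L[ℝ] (EuclideanSpace ℝ (Fin 3)))
      (yn : (EuclideanSpace ℝ (Fin 3))) (δn : ℝ),
      ABTower M Wn Pn Hn ∧ IsGalleryLimit U Wn ∧ ¬ RegPt Wn yn ∧ 0 < δn ∧
      ∀ t ∈ Ioo (-(δn ^ 2)) 0, ∀ x ∈ ball yn δn,
        Real.sqrt (-t) * ‖Wn t x‖ ≤ mstar + 1 / ((n : ℝ) + 1) := by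
    intro n
    obtain ⟨r, ⟨Wn, Pn, Hn, yn, hWn, hgn, hyn, rfl⟩, hlt⟩ :=
      exists_lt_of_csInf_lt hSne (lt_add_of_pos_right mstar (hθpos n))
    obtain ⟨δn, hδn, hr⟩ := (towerObj_of_abTower hWn).rateAt_of_tightRate_lt hlt
    exact ⟨Wn, Pn, Hn, yn, δn, hWn, hgn, hyn, hδn, hr⟩
  choose Wn Pn Hn yn δn hWn hgn hyn hδn hrn using hmin
  -- the recentred, renormalised fields and their A–B representatives
  set Vn : ℕ → ℝ → (EuclideanSpace ℝ (Fin 3)) → (EuclideanSpace ℝ (Fin 3)) :=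
    fun n => zoom (Wn n) (yn n) 0 (δn n) with hVndef
  have hVg : ∀ n, IsGalleryLimit U (Vn n) := fun n => (hgn n).galleryMap (yn n) (hδn n)
  have hVrate : ∀ n, ∀ s ∈ Ioo (-((1 : ℝ) ^ 2)) 0, ∀ z ∈ ball (0 : (EuclideanSpace ℝ (Fin 3))) 1,
      Real.sqrt (-s) * ‖Vn n s z‖ ≤ mstar + 1 / ((n : ℝ) + 1) := fun n =>
    rate_unit_of_rate (hδn n) (hrn n)
  have hVsing : ∀ n, ¬ RegPt (Vn n) 0 := fun n hr => hyn n (regPt_of_regPt_zoom_zero (hδn n) hr)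
  have hrep : ∀ n, ∃ (V' : ℝ → (EuclideanSpace ℝ (Fin 3)) → (EuclideanSpace ℝ (Fin 3)))
      (P' : ℝ → (EuclideanSpace ℝ (Fin 3)) → ℝ)
      (H' : ℝ → (EuclideanSpace ℝ (Fin 3)) → (EuclideanSpace ℝ (Fin 3)) →L[ℝ] (EuclideanSpace ℝ (Fin 3))),
      ABTower M V' P' H' ∧
      typeIBound (Iio (0 : ℝ) ×ˢ univ) V' P' H' ≤ 4 * typeIBound (Iio (0 : ℝ) ×ˢ univ) U P H ∧
      ∀ R : ℝ, 0 < R → ∀ᵐ z ∂(volume.restrict (parabolicCylinder R (0 : ℝ × (EuclideanSpace ℝ (Fin 3))))),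
        Vn n z.1 z.2 = V' z.1 z.2 := fun n => abTower_of_isGalleryLimit h (hVg n)
  choose V' P' H' hV'AB hV'I hV'ae using hrep
  have hV'g : ∀ n, IsGalleryLimit U (V' n) := fun n => (hVg n).congr_ae (hV'ae n)
  have hV'sing : ∀ n, ¬ RegPt (V' n) 0 := fun n hr =>
    hVsing n (regPt_zero_of_ae_eq hr fun R hR => (hV'ae n R hR).mono fun z hz => hz.symm)
  have hV'rate : ∀ n, ∀ᵐ z ∂(volume.restrict (parabolicCylinder 1 (0 : ℝ × (EuclideanSpace ℝ (Fin 3))))),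
      Real.sqrt (-z.1) * ‖V' n z.1 z.2‖ ≤ mstar + 1 / ((n : ℝ) + 1) := by
    intro n
    filter_upwards [rate_ae_unit_of_everywhere (hVrate n), hV'ae n 1 one_pos] with z hz hzz
    rw [← hzz]
    exact hz
  -- ## sequential compactness of the representatives (uniform budget `4 𝐈(U)`), persistence
  have hI4 : 4 * typeIBound (Iio (0 : ℝ) ×ˢ univ) U P H < ⊤ :=
    ENNReal.mul_lt_top (by simp) h.2.2.2
  obtain ⟨Wt, Pt, Ht, σ, hσ, hWtAB, -, hWt3, hconv, hpers⟩ :=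
    abTower_seqCompact hI4 V' P' H' hV'AB hV'I
  have hWtsing : ¬ RegPt Wt 0 := hpers 0 (Frequently.of_forall fun j => hV'sing (σ j))
  -- ## the rate `m⋆` passes to the limit, a.e. on `Q_1(0)`
  have hWtrate : ∀ᵐ z ∂(volume.restrict (parabolicCylinder 1 (0 : ℝ × (EuclideanSpace ℝ (Fin 3))))),
      Real.sqrt (-z.1) * ‖Wt z.1 z.2‖ ≤ mstar := by
    have hmeas : ∀ j, AEStronglyMeasurable (Function.uncurry (V' (σ j)))
        (volume.restrict (parabolicCylinder 1 (0 : ℝ × (EuclideanSpace ℝ (Fin 3))))) := fun j =>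
      (hV'AB (σ j)).aestronglyMeasurable_uncurry one_pos
    obtain ⟨ψ, hψ, hae⟩ := exists_subseq_tendsto_ae₃ hmeas (hWt3 1 one_pos).1 (hconv 1 one_pos)
    have hall := (ae_all_iff).2 fun j => hV'rate (σ (ψ j))
    filter_upwards [hae, hall] with z hz hzall
    have hb : Tendsto (fun j => mstar + 1 / (((σ (ψ j) : ℕ) : ℝ) + 1)) atTop (𝓝 mstar) := by
      have h1 : Tendsto (fun n : ℕ => 1 / ((n : ℝ) + 1)) atTop (𝓝 0) :=
        tendsto_one_div_add_atTop_nhds_zero_nat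
      have h2 : Tendsto (fun j => σ (ψ j)) atTop atTop :=
        hσ.tendsto_atTop.comp hψ.tendsto_atTop
      simpa using tendsto_const_nhds.add (h1.comp h2)
    refine le_of_tendsto_of_tendsto (hz.norm.const_mul (Real.sqrt (-z.1))) hb
      (Eventually.of_forall fun j => ?_)
    exact hzall j
  -- ## the limit is a gallery limit of `U`; take its A–B representative of budget `≤ 4 𝐈(U)`
  have hWtg : IsGalleryLimit U Wt :=
    IsGalleryLimit.of_tendsto (fun R hR => h.aestronglyMeasurable_uncurry hR)
      (fun j => hV'g (σ j)) hWt3 hconv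
  obtain ⟨W, PW, HW, hWAB, hWI, hWae⟩ := abTower_of_isGalleryLimit h hWtg
  have hWg : IsGalleryLimit U W := hWtg.congr_ae hWae
  have hWsing : ¬ RegPt W 0 := fun hr =>
    hWtsing (regPt_zero_of_ae_eq hr fun R hR => (hWae R hR).mono fun z hz => hz.symm)
  have hWrate_ae : ∀ᵐ z ∂(volume.restrict (parabolicCylinder 1 (0 : ℝ × (EuclideanSpace ℝ (Fin 3))))),
      Real.sqrt (-z.1) * ‖W z.1 z.2‖ ≤ mstar := by
    filter_upwards [hWtrate, hWae 1 one_pos] with z hz hzz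
    rw [← hzz]
    exact hz
  have hWrate : ∀ s ∈ Ioo (-((1 : ℝ) ^ 2)) 0, ∀ z ∈ ball (0 : (EuclideanSpace ℝ (Fin 3))) 1,
      Real.sqrt (-s) * ‖W s z‖ ≤ mstar :=
    rate_everywhere_of_ae (towerObj_of_abTower hWAB).2.1 hWrate_ae
  have hRate : RateAt mstar W 0 := ⟨1, one_pos, hWrate⟩
  have hle : tightRate W 0 ≤ mstar := tightRate_le_of_rateAt hRate
  have hge : mstar ≤ tightRate W 0 := hmstar_le hWAB hWg hWsing
  have heq : tightRate W 0 = mstar := le_antisymm hle hge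
  refine ⟨W, PW, HW, hWAB, hWg, hWI, hWsing, ?_, fun W₂ P₂ H₂ y₂ hW₂ hg₂ hy₂ => ?_⟩
  · rw [heq]
    exact hWrate
  · rw [heq]
    exact hmstar_le hW₂ hg₂ hy₂

/-- **Rooted form.**  For a ROOTED A–B object `U` the gallery-wise minimal singular rate exists and
is attained: some A–B gallery limit `W` of `U` (budget `≤ 4·𝐈(U)`) is singular at the root with
root tight rate `≤ tightRate U 0` and minimal over all scars in the gallery of `U`. -/
theorem ABTower.exists_galleryMinimiser_of_rooted {M : ℝ}
    {H : ℝ → (EuclideanSpace ℝ (Fin 3)) → (EuclideanSpace ℝ (Fin 3)) →L[ℝ] (EuclideanSpace ℝ (Fin 3))}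
    (h : ABTower M U P H) (h0 : ¬ RegPt U 0) :
    ∃ (W : ℝ → (EuclideanSpace ℝ (Fin 3)) → (EuclideanSpace ℝ (Fin 3))) (P' : ℝ → (EuclideanSpace ℝ (Fin 3)) → ℝ)
      (H' : ℝ → (EuclideanSpace ℝ (Fin 3)) → (EuclideanSpace ℝ (Fin 3)) →L[ℝ] (EuclideanSpace ℝ (Fin 3))),
      ABTower M W P' H' ∧ IsGalleryLimit U W ∧
      typeIBound (Iio (0 : ℝ) ×ˢ univ) W P' H' ≤ 4 * typeIBound (Iio (0 : ℝ) ×ˢ univ) U P H ∧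
      ¬ RegPt W 0 ∧ tightRate W 0 ≤ tightRate U 0 ∧
      (∀ s ∈ Ioo (-((1 : ℝ) ^ 2)) 0, ∀ z ∈ ball (0 : (EuclideanSpace ℝ (Fin 3))) 1,
        Real.sqrt (-s) * ‖W s z‖ ≤ tightRate W 0) ∧
      ∀ (W₂ : ℝ → (EuclideanSpace ℝ (Fin 3)) → (EuclideanSpace ℝ (Fin 3))) (P₂ : ℝ → (EuclideanSpace ℝ (Fin 3)) → ℝ)
        (H₂ : ℝ → (EuclideanSpace ℝ (Fin 3)) → (EuclideanSpace ℝ (Fin 3)) →L[ℝ] (EuclideanSpace ℝ (Fin 3)))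
        (y₂ : (EuclideanSpace ℝ (Fin 3))),
        ABTower M W₂ P₂ H₂ → IsGalleryLimit U W₂ → ¬ RegPt W₂ y₂ → tightRate W 0 ≤ tightRate W₂ y₂ := by
  obtain ⟨W, P', H', hW, hg, hI, hs, hr, hmin⟩ := h.exists_galleryMinimiser h h.isGalleryLimit_refl h0
  exact ⟨W, P', H', hW, hg, hI, hs, hmin U P H 0 h h.isGalleryLimit_refl h0, hr, hmin⟩

end GalleryMinRate

end Summit.NavierStokesRegularity.NavierStokesRegularity.Cruxes.ScarEnvelopeTypeI.ZoomDictionary
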